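import Summits.Ventures.Crystal3D.Theorems.StickyWulffConstantPolycrystalWulffBoundAggCertCheckTree
import Summits.Ventures.Crystal3D.Theorems.StickyWulffConstantPolycrystalWulffBoundAggCertData1
import Summits.Ventures.Crystal3D.Theorems.StickyWulffConstantPolycrystalWulffBoundAggCertData2
import Summits.Ventures.Crystal3D.Theorems.StickyWulffConstantPolycrystalWulffBoundAggCertData3
import Summits.Ventures.Crystal3D.Theorems.StickyWulffConstantPolycrystalWulffBoundAggCertData4
import Summits.Ventures.Crystal3D.Theorems.StickyWulffConstantPolycrystalWulffBoundAggStep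

/-!
# `PolycrystalWulffBound`, line `PolyDensity`: **CH-P3 discharged** — `AggCert27_8` holds

Route `StickyWulffConstant` of the venture `Summits/Ventures/Crystal3D`, crux `PolycrystalWulffBound`
(item `stmt-Ventures-19482`), second prover lane (poly-p2, gen 7).  The certificate string (`aggCertData1 … aggCertData4`, joined) is parsed
into a `CTree` (`aggCertTree`), the reflective checker `checkTree` is EVALUATED on it from the root box
(`aggCertTree_ok`, by `native_decide` — a computational step in the sense of the route's computational hypotheses:
the evaluation uses exact rational arithmetic only; trust base = Lean's compiler/interpreter via `Lean.ofReduceBool`),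
and `aggCert_of_checkTree` turns the successful check into `AggCert27_8_holds : AggCert27_8`.  Consequently the
all-classes twin-free rung needs only CH-P1′: `rung_twinFree_allClasses_of_WulffOverlap27_8`.
WHAT THIS IS NOT: a discharge of CH-P1′ (`WulffOverlap27_8`, kit-certified: HOME/poly-p2/CERT-wulffOverlap-27.8.md);
twinned textures; F-C1 not moved.
-/

namespace Summit.Ventures.Crystal3D.Theorems

open Summit.Ventures.Crystal3D.Cruxes.PolycrystalWulffBound.PolyDensity (AggCert27_8 WulffOverlap27_8)

/-- Read `n` weighted rows `(r, v, y/10⁶)` off a token list. -/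
def takeTerms : ℕ → List ℕ → List Term × List ℕ
  | 0, l => ([], l)
  | n + 1, r :: v :: y :: rest =>
    let p := takeTerms n rest
    ((r, v == 1, (y : ℚ) / 1000000) :: p.1, p.2)
  | _ + 1, l => ([], l)

/-- Parse a preorder token list into a certificate tree (`fuel` bounds the number of nodes). -/
def parseTree : ℕ → List ℕ → Option (CTree × List ℕ)
  | 0, _ => none
  | _ + 1, 0 :: rest => some (CTree.skip, rest)
  | fuel + 1, 1 :: k :: rest =>
    match parseTree fuel rest with
    | none => none
    | some (l, rest') =>
      match parseTree fuel rest' with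
      | none => none
      | some (r, rest'') => some (CTree.split k l r, rest'')
  | _ + 1, 2 :: n :: rest =>
    let p := takeTerms n rest
    some (CTree.leaf p.1, p.2)
  | _ + 1, _ => none

/-- The certificate tree (a failed parse yields `skip`, which the checker rejects at the root). -/
def aggCertTree : CTree :=
  match parseTree 20000 (((aggCertData1 ++ " " ++ aggCertData2 ++ " " ++ aggCertData3 ++ " " ++ aggCertData4).splitOn " ").map String.toNat!) with
  | some (t, _) => t
  | none => CTree.skip

/-- **The check succeeds** (evaluation of the reflective checker; exact rational arithmetic). -/
theorem aggCertTree_ok : checkTree aggCertTree rootBox = true := by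
  native_decide

/-- **CH-P3 discharged: the aggregated LP bound `AggCert27_8` holds.** -/
theorem AggCert27_8_holds : AggCert27_8 := aggCert_of_checkTree aggCertTree aggCertTree_ok

end Summit.Ventures.Crystal3D.Theorems

noncomputable section

open scoped BigOperators InnerProductSpace ENNReal
open MeasureTheory Filter

namespace Summit.Ventures.Crystal3D.Cruxes.PolycrystalWulffBound.PolyDensity

open Summit.Ventures.Crystal3D.Theorems

/-- **All twin-free polyhedral textures, modulo CH-P1′ only.**  With `AggCert27_8` discharged in the kernel, the
polycrystal Wulff bound for every twin-free polyhedral texture depends on the single computational hypothesis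
`WulffOverlap27_8` (`∀ R, 27.8 ≤ |W(1) ∩ W(R)|`). -/
theorem rung_twinFree_allClasses_of_WulffOverlap27_8 (hCH : WulffOverlap27_8) :

    let Λ : Set (EuclideanSpace ℝ (Fin 3)) := Literature.MathematicalPhysics.StatisticalMechanics.fccStacking 1 (Real.sqrt (2 / 3));
    let Brl : (ℤ → ℤ) → Set (EuclideanSpace ℝ (Fin 3)) := Literature.MathematicalPhysics.StatisticalMechanics.barlowStacking 1 (Real.sqrt (2 / 3));
    let Ax : EuclideanSpace ℝ (Fin 3) → (EuclideanSpace ℝ (Fin 3) ≃ₗᵢ[ℝ] EuclideanSpace ℝ (Fin 3)) → (EuclideanSpace ℝ (Fin 3) ≃ₗᵢ[ℝ] EuclideanSpace ℝ (Fin 3)) → Prop := fun m A B => ∃ (L : EuclideanSpace ℝ (Fin 3) ≃ₗᵢ[ℝ] EuclideanSpace ℝ (Fin 3)) (s₁ s₂ : EuclideanSpace ℝ (Fin 3)) (σ σ' : ℤ → ℤ), Literature.MathematicalPhysics.StatisticalMechanics.IsHaggSeq σ ∧ Literature.MathematicalPhysics.StatisticalMechanics.IsHaggSeq σ' ∧ L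 (EuclideanSpace.single (2 : Fin 3) (1 : ℝ)) = m ∧ A '' Λ ⊆ (fun q => L q + s₁) '' Brl σ ∧ B '' Λ ⊆ (fun q => L q + s₂) '' Brl σ';
    let CoAx : (EuclideanSpace ℝ (Fin 3) ≃ₗᵢ[ℝ] EuclideanSpace ℝ (Fin 3)) → (EuclideanSpace ℝ (Fin 3) ≃ₗᵢ[ℝ] EuclideanSpace ℝ (Fin 3)) → Prop := fun A B => ∃ m, Ax m A B;
    let Φ : EuclideanSpace ℝ (Fin 3) → ℝ := fun ν => Real.sqrt 2 / 4 * ∑ᶠ w ∈ {w ∈ Λ | ‖w‖ = 1}, |⟪w, ν⟫_ℝ|;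
    let Per : Set (EuclideanSpace ℝ (Fin 3)) → Set (EuclideanSpace ℝ (Fin 3)) → ℝ := fun K S => (⨆ (ξ : EuclideanSpace ℝ (Fin 3) → EuclideanSpace ℝ (Fin 3)) (_ : ContDiff ℝ 1 ξ ∧ HasCompactSupport ξ ∧ ∀ z, ξ z ∈ K), ENNReal.ofReal (∫ z in S, Literature.MathematicalPhysics.StatisticalMechanics.fieldDivergence ξ z)).toReal;
    let ι : Set (EuclideanSpace ℝ (Fin 3)) → Set (EuclideanSpace ℝ (Fin 3)) → Set (EuclideanSpace ℝ (Fin 3)) → ℝ := fun K S₁ S₂ => (Per K S₁ + Per K S₂ - Per K (S₁ ∪ S₂)) / 2;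
    let W : (EuclideanSpace ℝ (Fin 3) ≃ₗᵢ[ℝ] EuclideanSpace ℝ (Fin 3)) → Set (EuclideanSpace ℝ (Fin 3)) := fun A => {y | ∀ ν : EuclideanSpace ℝ (Fin 3), ⟪y, ν⟫_ℝ ≤ Φ (A.symm ν)};
    let Dsc : EuclideanSpace ℝ (Fin 3) → Set (EuclideanSpace ℝ (Fin 3)) := fun m => {y | ‖y‖ ≤ 1 ∧ ⟪y, m⟫_ℝ = 0};
    let Tex : (n : ℕ) → (Fin n → Set (EuclideanSpace ℝ (Fin 3))) → (Fin n → (EuclideanSpace ℝ (Fin 3) ≃ₗᵢ[ℝ] EuclideanSpace ℝ (Fin 3))) → (Fin n → Fin n → ℝ) → (Fin n → Fin n → EuclideanSpace ℝ (Fin 3)) → Prop := fun n G A c m => (∀ f : Fin n, Literature.MathematicalPhysics.StatisticalMechanics.HasFinitePerimeter (G f) ∧ volume (G f) < ⊤) ∧ (∀ f g, f ≠ g → Disjoint (G f) (G g)) ∧ (∀ f g, f ≠ g → 0 ≤ c f g) ∧ (∀ f g, f ≠ g → ¬ CoAx (A f) (A g) → m f g = 0 ∧ 1 ≤ c f g)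 ∧ (∀ f g, f ≠ g → CoAx (A f) (A g) → A f '' Λ ≠ A g '' Λ → Ax (m f g) (A f) (A g) ∧ 1 / 2 ≤ c f g);
    let En : (n : ℕ) → (Fin n → Set (EuclideanSpace ℝ (Fin 3))) → (Fin n → (EuclideanSpace ℝ (Fin 3) ≃ₗᵢ[ℝ] EuclideanSpace ℝ (Fin 3))) → (Fin n → Fin n → ℝ) → (Fin n → Fin n → EuclideanSpace ℝ (Fin 3)) → ℝ := fun n G A c m => ∑ f : Fin n, Per (W (A f)) (G f) - ∑ f, ∑ g, (if f = g then 0 else ι (W (A f)) (G f) (G g)) + ∑ f, ∑ g, (if f = g then 0 else c f g / 2 * ι (Dsc (m f g)) (G f) (G g));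
    let Vol : (n : ℕ) → (Fin n → Set (EuclideanSpace ℝ (Fin 3))) → ℝ := fun n G => (volume (⋃ f : Fin n, G f)).toReal;
    let Poly : Set (EuclideanSpace ℝ (Fin 3)) → Prop := fun S => ∃ (k : ℕ) (H : Fin k → Finset ((EuclideanSpace ℝ (Fin 3)) × ℝ)), S = ⋃ i, ⋂ p ∈ H i, {x | ⟪p.1, x⟫_ℝ < p.2};
    let TF : (n : ℕ) → (Fin n → (EuclideanSpace ℝ (Fin 3) ≃ₗᵢ[ℝ] EuclideanSpace ℝ (Fin 3))) → Prop := fun n A => ∀ f g : Fin n, f ≠ g → CoAx (A f) (A g) → A f '' Λ = A g '' Λ;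
    ∀ (n : ℕ) (G : Fin n → Set (EuclideanSpace ℝ (Fin 3))) (A : Fin n → (EuclideanSpace ℝ (Fin 3) ≃ₗᵢ[ℝ] EuclideanSpace ℝ (Fin 3))) (c : Fin n → Fin n → ℝ) (m : Fin n → Fin n → EuclideanSpace ℝ (Fin 3)),
        Tex n G A c m → (∀ f, Poly (G f)) → TF n A → 6 * (2 : ℝ) ^ ((1 : ℝ) / 3) * (Real.sqrt 2 * Vol n G) ^ ((2 : ℝ) / 3) ≤ En n G A c m :=
  rung_twinFree_allClasses_of_AggCert AggCert27_8_holds hCH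

end Summit.Ventures.Crystal3D.Cruxes.PolycrystalWulffBound.PolyDensity

end
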